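import HarnessLib
import Summits.RiemannHypothesis.RiemannHypothesis.Theorems.WeilFormatCDataA1TabValid1
import Summits.RiemannHypothesis.RiemannHypothesis.Theorems.WeilFormatCDataA1TabValidK2
import Summits.RiemannHypothesis.RiemannHypothesis.Theorems.WeilFormatCDataA1TabValidK3
import Summits.RiemannHypothesis.RiemannHypothesis.Theorems.WeilFormatCDataA1TabValidK4
import Summits.Ventures.WeilGRH.TwistedGramCellCheckCK2
import Summits.Ventures.WeilGRH.TwistedGramCellConsts
import Literature.NumberTheory.LFunctions.WeilExplicitDirichletConj
import Summits.Ventures.WeilGRH.KCellsMod7OneAData1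
import Summits.Ventures.WeilGRH.KCellsMod7OneAData2
import Summits.Ventures.WeilGRH.KCellsMod7OneAData3
import Summits.Ventures.WeilGRH.KCellsMod7OneAData4
import Summits.Ventures.WeilGRH.KCellsMod7OneAData5
import Summits.Ventures.WeilGRH.KCellsMod7OneAData6
import Summits.Ventures.WeilGRH.KCellsMod7OneAData7
import Summits.Ventures.WeilGRH.KCellsMod7OneAData8
import Summits.Ventures.WeilGRH.KCellsMod7OneAData9
import Summits.Ventures.WeilGRH.KCellsMod7OneAData10
import Summits.Ventures.WeilGRH.KCellsMod7OneAData11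
import Summits.Ventures.WeilGRH.KCellsMod7OneAData12
import Summits.Ventures.WeilGRH.KCellsMod7OneAData13

/-!
SPLIT 14/14: the data and the kernel blocks of cell `c7h2` are in `KCellsMod7OneAData1`, `KCellsMod7OneAData2`, `KCellsMod7OneAData3`, `KCellsMod7OneAData4`, `KCellsMod7OneAData5`, `KCellsMod7OneAData6`, `KCellsMod7OneAData7`, `KCellsMod7OneAData8`, `KCellsMod7OneAData9`, `KCellsMod7OneAData10`, `KCellsMod7OneAData11`, `KCellsMod7OneAData12`, `KCellsMod7OneAData13`; this file carries the last blocks, the glue, the PSD certificate and the theorems.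
ENGINE v2 (weil-grh-2 gen15): cell checker `K` (`TwistedGramCellCheckCK`: far rows tabulated once, Schur column sums by ONE Kronecker big-integer product per pair, front door `TwistedEncl.weilPositivityOnChar_of_checkCellK`); the midpoint matrix `D` and the Cholesky factor `L` are carried PACKED (one numeral per row, 64-bit words offset `2^63`, `PsdDyadic.unpackSq` / `unpackTri`) — the statements proved are unchanged.
# χ-cells mod 7 at `t = 1` (1 even complex class + conjugates): Weil positivity for `L(s, χ)` on `[−1, 1]`

Cell `rh-explicit`, WEIL TRACK — GRH ARM (engine seat weil-grh-2 gen14).  Kernel-checked INSTANCES of the parity-0 complex data door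
`weilPositivityOnChar_of_twistedC_formatC_dataJ` (order `J = 1`) via the cell checker's front door `TwistedEncl.weilPositivityOnChar_of_checkCellC`
(`TwistedGramCellCheckC` / `…CDoor`) at the window `a = 1` of the internal `ζ` record `WeilFormatCData.A1` (prime powers `2, 3, 4, 5, 7 < e²`,
`S = 2^256`; table validity below `161` assembled inside each proof from weil-2's kernel facts `tabv26`, `tTF26`, …).
The character values are general roots of unity (orders not square-root expressible in general), so `χ(k)` enters the cell checker through
kernel-certified BOXES: `Xtabf7a[j] ∋ e(m_j/6) = exp(2πi·m_j/6)` for the exponents `m_j` of `mtabf7a` (`MC.expI` on the table's `π` box, ONE kernel check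
`tXf7a`; membership `hXf7a` by `MC.mem_expI`), and `χ(k) = χ(3)^e = exp(2πi·h·e/6)` for `k ≡ 3^e (mod 7)` from the class hypothesis `χ(3) = exp(2πi/6)^h`
(`3` generates `(ℤ/7)ˣ`, order 6; local `apply_eq` in each `hXs…`).  SHARED (tag `f7a`): `LQf7a ∋ log 7`, `CCf7a ∋ a(1+E(2a))`, `AOPf7a ∋ Σ Λ(k)/√k·2cos(π/(n_k+2))`
(floors `[2, 1, 1, 1, 1]`), the cell shape `df7a` — block `B = 40` (`79 × 79` on `|p| < 40`), Schur columns `40 ≤ |p| < 160`, far weights `wN` (units `2^-40`,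
shaved `2^16` below the kernel's `dhatCBoxA` lower bounds), crude floor `d₀` (all depend on `q` only) — and ONE sign check `tSCf7a`.
PER CELL: the five boxes `Xs…` of `χ(2), χ(3), χ(4), χ(5), χ(7)`, tail parameters `θ, η`, dyadic midpoints `D…` (units `2^-60`, radius `ρ`) and the integer
Cholesky factor `L…` of `D − δ` (kernel margin `λ` informative); all 2B−1 rows checked by ONE `checkCellCRows` kernel call (`maxRecDepth 200000`), `PsdDyadic.checkPsdMid`.
CLASSES: `χ(3) = e(2/6)` (Conrey 7.2 / conj. 7.4, order 3, λ = 0.000).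
Final theorems `weilPositivityOnChar_mod7_chi<m>_one (χ : DirichletCharacter ℂ 7) (hχ : χ (3 : ZMod 7) = exp(2πi/6) ^ h) : WeilPositivityOnChar χ 1` and
`…_conj` (the conjugate class `h ↦ 6 − h`, via `WeilPositivityOnChar χ⁻¹ a ↔ WeilPositivityOnChar χ a`).
Pure data + kernel checks + the typed door; RH/GRH-free; standard axioms.  References: H. Yoshida (1992) §§5–7 [Yoshida1992HermitianForms];
R. E. Moore (1966) Ch. 3 [Moore1966]; N. J. Higham (2002) [Higham2002ASNA].
-/

set_option linter.style.longLine false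

noncomputable section

namespace Summit.Ventures.WeilGRH.KCellsMod7OneA
open Literature.NumberTheory.LFunctions Literature.NumberTheory.LFunctions.Yoshida1992 Encl
open Literature.Analysis.ValidatedNumerics.NumericsMP Literature.Analysis.SpecialFunctions
open Summit.RiemannHypothesis.RiemannHypothesis.Theorems.WeilFormatCData.A1
open Summit.Ventures.WeilGRH.TwistedEncl
open scoped Real ComplexConjugate
set_option maxRecDepth 200000 in
/-- cell `c7h2`, rows `72…78`, columns `40…59` (checker `K`): re-computed entries within `ρ·2^-60` of the midpoints (one kernel call). [cite: Moore1966, Ch. 3 (interval arithmetic: inclusion property)] -/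
theorem tK72x40c7h2 : checkCellK2Block (2 ^ 256) C (Xsc7h2.map MC.re) (Xsc7h2.map MC.im) LQf7a tab df7a ec7h2 fc7h2 60 2 (PsdDyadic.unpackSq 64 79 DPc7h2) 72 7 40 20 = true := by
  set_option maxHeartbeats 0 in decide +kernel
set_option maxRecDepth 200000 in
/-- cell `c7h2`, rows `72…78`, columns `60…78` (checker `K`): re-computed entries within `ρ·2^-60` of the midpoints (one kernel call). [cite: Moore1966, Ch. 3 (interval arithmetic: inclusion property)] -/
theorem tK72x60c7h2 : checkCellK2Block (2 ^ 256) C (Xsc7h2.map MC.re) (Xsc7h2.map MC.im) LQf7a tab df7a ec7h2 fc7h2 60 2 (PsdDyadic.unpackSq 64 79 DPc7h2) 72 7 60 19 = true := by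
  set_option maxHeartbeats 0 in decide +kernel
/-- cell `c7h2`, rows `0…11`, all columns (glued). [folklore] -/
theorem tK0c7h2 : checkCellK2Block (2 ^ 256) C (Xsc7h2.map MC.re) (Xsc7h2.map MC.im) LQf7a tab df7a ec7h2 fc7h2 60 2 (PsdDyadic.unpackSq 64 79 DPc7h2) 0 12 0 79 = true :=
  (checkCellK2Block_glueCols (checkCellK2Block_glueCols (checkCellK2Block_glueCols tK0x0c7h2 tK0x20c7h2 rfl rfl) tK0x40c7h2 rfl rfl) tK0x60c7h2 rfl rfl)
/-- cell `c7h2`, rows `12…23`, all columns (glued). [folklore] -/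
theorem tK12c7h2 : checkCellK2Block (2 ^ 256) C (Xsc7h2.map MC.re) (Xsc7h2.map MC.im) LQf7a tab df7a ec7h2 fc7h2 60 2 (PsdDyadic.unpackSq 64 79 DPc7h2) 12 12 0 79 = true :=
  (checkCellK2Block_glueCols (checkCellK2Block_glueCols (checkCellK2Block_glueCols tK12x0c7h2 tK12x20c7h2 rfl rfl) tK12x40c7h2 rfl rfl) tK12x60c7h2 rfl rfl)
/-- cell `c7h2`, rows `24…35`, all columns (glued). [folklore] -/
theorem tK24c7h2 : checkCellK2Block (2 ^ 256) C (Xsc7h2.map MC.re) (Xsc7h2.map MC.im) LQf7a tab df7a ec7h2 fc7h2 60 2 (PsdDyadic.unpackSq 64 79 DPc7h2) 24 12 0 79 = true :=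
  (checkCellK2Block_glueCols (checkCellK2Block_glueCols (checkCellK2Block_glueCols tK24x0c7h2 tK24x20c7h2 rfl rfl) tK24x40c7h2 rfl rfl) tK24x60c7h2 rfl rfl)
/-- cell `c7h2`, rows `36…47`, all columns (glued). [folklore] -/
theorem tK36c7h2 : checkCellK2Block (2 ^ 256) C (Xsc7h2.map MC.re) (Xsc7h2.map MC.im) LQf7a tab df7a ec7h2 fc7h2 60 2 (PsdDyadic.unpackSq 64 79 DPc7h2) 36 12 0 79 = true :=
  (checkCellK2Block_glueCols (checkCellK2Block_glueCols (checkCellK2Block_glueCols tK36x0c7h2 tK36x20c7h2 rfl rfl) tK36x40c7h2 rfl rfl) tK36x60c7h2 rfl rfl)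
/-- cell `c7h2`, rows `48…59`, all columns (glued). [folklore] -/
theorem tK48c7h2 : checkCellK2Block (2 ^ 256) C (Xsc7h2.map MC.re) (Xsc7h2.map MC.im) LQf7a tab df7a ec7h2 fc7h2 60 2 (PsdDyadic.unpackSq 64 79 DPc7h2) 48 12 0 79 = true :=
  (checkCellK2Block_glueCols (checkCellK2Block_glueCols (checkCellK2Block_glueCols tK48x0c7h2 tK48x20c7h2 rfl rfl) tK48x40c7h2 rfl rfl) tK48x60c7h2 rfl rfl)
/-- cell `c7h2`, rows `60…71`, all columns (glued). [folklore] -/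
theorem tK60c7h2 : checkCellK2Block (2 ^ 256) C (Xsc7h2.map MC.re) (Xsc7h2.map MC.im) LQf7a tab df7a ec7h2 fc7h2 60 2 (PsdDyadic.unpackSq 64 79 DPc7h2) 60 12 0 79 = true :=
  (checkCellK2Block_glueCols (checkCellK2Block_glueCols (checkCellK2Block_glueCols tK60x0c7h2 tK60x20c7h2 rfl rfl) tK60x40c7h2 rfl rfl) tK60x60c7h2 rfl rfl)
/-- cell `c7h2`, rows `72…78`, all columns (glued). [folklore] -/
theorem tK72c7h2 : checkCellK2Block (2 ^ 256) C (Xsc7h2.map MC.re) (Xsc7h2.map MC.im) LQf7a tab df7a ec7h2 fc7h2 60 2 (PsdDyadic.unpackSq 64 79 DPc7h2) 72 7 0 79 = true :=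
  (checkCellK2Block_glueCols (checkCellK2Block_glueCols (checkCellK2Block_glueCols tK72x0c7h2 tK72x20c7h2 rfl rfl) tK72x40c7h2 rfl rfl) tK72x60c7h2 rfl rfl)
/-- cell `c7h2`: the full `79 × 79` block (checker `K`, glued). [folklore] -/
theorem tRowsc7h2 : checkCellK2Block (2 ^ 256) C (Xsc7h2.map MC.re) (Xsc7h2.map MC.im) LQf7a tab df7a ec7h2 fc7h2 60 2 (PsdDyadic.unpackSq 64 79 DPc7h2) 0 79 0 79 = true :=
  (checkCellK2Block_glueRows (checkCellK2Block_glueRows (checkCellK2Block_glueRows (checkCellK2Block_glueRows (checkCellK2Block_glueRows (checkCellK2Block_glueRows tK0c7h2 tK12c7h2 rfl rfl) tK24c7h2 rfl rfl) tK36c7h2 rfl rfl) tK48c7h2 rfl rfl) tK60c7h2 rfl rfl) tK72c7h2 rfl rfl)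
/-- `D − δ ≽ 0` with row slack `≥ ρ`. [cite: Higham2002ASNA, Thm. 10.3 / 10.5 (Cholesky backward error; Wilkinson–Demmel)] -/
theorem tPsdc7h2 : PsdDyadic.checkPsdMid 79 90130433287134 2 (PsdDyadic.unpackSq 64 79 DPc7h2) (PsdDyadic.unpackTri 64 LPc7h2) = true := by
  decide +kernel
/-- cell `c7h2`: the five character values lie in the boxes `Xsc7h2`. [folklore] -/
theorem hXsc7h2 (χ : DirichletCharacter ℂ 7) (hχ : χ (3 : ZMod 7) = Complex.exp (2 * ↑Real.pi * Complex.I / 6) ^ 2) :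
    ∀ i < ks.length, MC.mem (2 ^ 256) (χ ((((ks.getD i default).val : ℕ)) : ZMod 7)) (Xsc7h2.getD i default) := by
  have apply_eq : ∀ k e m : ℕ, ((k : ℕ) : ZMod 7) = (3 : ZMod 7) ^ e → 2 * e = m →
      χ ((k : ℕ) : ZMod 7) = Complex.exp (((2 * π * (m : ℕ) / 6 : ℝ)) * Complex.I) := by
    intro k e m hk hm
    rw [hk, map_pow, hχ, ← pow_mul, hm, ← Complex.exp_nat_mul]
    congr 1
    push_cast
    ring
  intro i hi
  have hi5 : i < 5 := by simpa [ks] using hi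
  interval_cases i
  · show MC.mem (2 ^ 256) (χ (((PrimeLen.val ⟨2, 1⟩ : ℕ)) : ZMod 7)) (Xtabf7a.getD 1 default)
    rw [show (PrimeLen.val ⟨2, 1⟩ : ℕ) = 2 from rfl, apply_eq 2 2 4 (by decide +kernel) rfl]
    exact hXf7a 1 (by norm_num)
  · show MC.mem (2 ^ 256) (χ (((PrimeLen.val ⟨3, 1⟩ : ℕ)) : ZMod 7)) (Xtabf7a.getD 0 default)
    rw [show (PrimeLen.val ⟨3, 1⟩ : ℕ) = 3 from rfl, apply_eq 3 1 2 (by decide +kernel) rfl]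
    exact hXf7a 0 (by norm_num)
  · show MC.mem (2 ^ 256) (χ (((PrimeLen.val ⟨2, 2⟩ : ℕ)) : ZMod 7)) (Xtabf7a.getD 2 default)
    rw [show (PrimeLen.val ⟨2, 2⟩ : ℕ) = 4 from rfl, apply_eq 4 4 8 (by decide +kernel) rfl]
    exact hXf7a 2 (by norm_num)
  · show MC.mem (2 ^ 256) (χ (((PrimeLen.val ⟨5, 1⟩ : ℕ)) : ZMod 7)) (Xtabf7a.getD 3 default)
    rw [show (PrimeLen.val ⟨5, 1⟩ : ℕ) = 5 from rfl, apply_eq 5 5 10 (by decide +kernel) rfl]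
    exact hXf7a 3 (by norm_num)
  · show MC.mem (2 ^ 256) (χ (((PrimeLen.val ⟨7, 1⟩ : ℕ)) : ZMod 7)) (MC.ofInt (2 ^ 256) 0)
    rw [show (PrimeLen.val ⟨7, 1⟩ : ℕ) = 7 from rfl, MulChar.map_nonunit χ (by rw [ZMod.isUnit_iff_coprime]; decide)]
    exact_mod_cast MC.mem_ofInt (2 ^ 256) 0
/-- ★ **Weil positivity on `[−1, 1]` for `L(s, χ)`, `χ` mod 7 with `χ(3) = e(2/6)`** (Conrey `7.2`, order 3; door C at `a = 1`,
shape `40`/`160`, kernel margin `λ = 0.0002`). -/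
theorem weilPositivityOnChar_mod7_chi2_one (χ : DirichletCharacter ℂ 7) (hχ : χ (3 : ZMod 7) = Complex.exp (2 * ↑Real.pi * Complex.I / 6) ^ 2) :
    WeilPositivityOnChar χ 1 := by
  have hXs := hXsc7h2 χ hχ
  have hx : ∀ i < ks.length, MI.mem (2 ^ 256) (χ ((((ks.getD i default).val : ℕ)) : ZMod 7)).re ((Xsc7h2.map MC.re).getD i default) := fun i hi ↦ by
    show MI.mem _ _ ((Xsc7h2.map MC.re).getD i (MC.re default)); rw [List.getD_map]; exact (hXs i hi).1
  have hy : ∀ i < ks.length, MI.mem (2 ^ 256) (χ ((((ks.getD i default).val : ℕ)) : ZMod 7)).im ((Xsc7h2.map MC.im).getD i default) := fun i hi ↦ by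
    show MI.mem _ _ ((Xsc7h2.map MC.im).getD i (MC.im default)); rw [List.getD_map]; exact (hXs i hi).2
  have hT : TabValid (2 ^ 256) a ks 161 tab :=
    (((((((((tabv26).extend fun n hn hnk ↦ FastLight.idxValid_of_checkTableFast (by norm_num) a_pos consts_valid tTF26 hn hnk).extend fun n hn hnk ↦ FastLight.idxValid_of_checkTableFast (by norm_num) a_pos consts_valid tTF41 hn hnk).extend fun n hn hnk ↦ FastLight.idxValid_of_checkTableFast (by norm_num) a_pos consts_valid tTF56 hn hnk).extend fun n hn hnk ↦ FastLight.idxValid_of_checkTableFast (by norm_num) a_pos consts_valid tTF71 hn hnk).extend fun n hn hnk ↦ FastLight.idxValid_of_checkTableFast (by norm_num) a_pos consts_valid tTF86 hn hnk).extend fun n hn hnk ↦ FastLight.idxValid_of_checkTableFast (by norm_num) a_pos consts_valid tTF101 hn hnk).extend fun n hn hnk ↦ FastLight.idxValid_of_checkTableFast (by norm_num) a_pos consts_valid tTF116 hn hnk).extend fun n hn hnk ↦ FastLight.idxValid_of_checkTableFast (by norm_num) a_pos consts_valid tTF131 hn hnk).extend fun n hn hnk ↦ FastLight.idxValid_of_checkTableFast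 (by norm_num) a_pos consts_valid tTF146 hn hnk
  have h := weilPositivityOnChar_of_checkCellK2 (q := 7) (by norm_num) (by positivity) a_pos (Karc := 128) primeData consts_valid χ hx hy
    hLQf7a hT (d := df7a) (e := ec7h2) (by decide) hCCf7a hAOPf7a tSCf7a tHDc7h2 tRowsc7h2 tPsdc7h2
  convert h using 2
  norm_num [a]
/-- ★ the CONJUGATE class `χ(3) = e(4/6)` (Conrey `7.4`): `weilPositivityOnChar_mod7_chi2_one` for `χ⁻¹`, transferred by
`WeilPositivityOnChar χ⁻¹ a ↔ WeilPositivityOnChar χ a`. -/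
theorem weilPositivityOnChar_mod7_chi2_one_conj (χ : DirichletCharacter ℂ 7) (hχ : χ (3 : ZMod 7) = Complex.exp (2 * ↑Real.pi * Complex.I / 6) ^ 4) :
    WeilPositivityOnChar χ 1 := by
  have hinv : χ⁻¹ (3 : ZMod 7) = Complex.exp (2 * ↑Real.pi * Complex.I / 6) ^ 2 := by
    rw [MulChar.inv_apply_eq_inv', hχ]
    exact inv_eq_of_mul_eq_one_right (by rw [← pow_add]; exact_mod_cast (Complex.isPrimitiveRoot_exp 6 (by norm_num)).pow_eq_one)
  exact (weilPositivityOnChar_inv_iff χ 1).mp (weilPositivityOnChar_mod7_chi2_one χ⁻¹ hinv)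

end Summit.Ventures.WeilGRH.KCellsMod7OneA

end
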